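import Literature.Computability.Cryptography.RegevReductionResiduals
import HarnessLib

/-!
# Regev 2009, Theorem 3.1 at the machine level: residual A split along the lemma boundary of the
# printed proof — Lemma 3.2 (the bootstrapping sampler, classical) and Lemma 3.3 (the iterative step)

Topic `Computability/Cryptography` (family `pqc`), sequel of `RegevReductionResiduals.lean`. O. Regev,
*On lattices, learning with errors, random linear codes, and cryptography*, J. ACM 56 (2009), art. 34
(author's version arXiv:2401.03703, whose page numbers are quoted), proof of Theorem 3.1 (p. 15): the
`DGS` sampler first calls the procedure of **Lemma 3.2** ("there exists an efficient algorithm that,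
given any `n`-dimensional lattice `L` and `r > 2^{2n} λ_n(L)`, outputs a sample from a distribution
that is within statistical distance `2^{-Ω(n)}` of `D_{L,r}`"; proof: LLL, then Babai / rounding of a
continuous Gaussian — a CLASSICAL randomised procedure) at the radius `r_{3n} = r·(αp/√n)^{3n} >
2^{2n} λ_n(L)`, then `3n` times the procedure of **Lemma 3.3** ("there exists an efficient quantum
algorithm that, given any `n`-dimensional lattice `L`, a number `r > √2 p η_ε(L)`, and `n^c` samples
from `D_{L,r}`, produces a sample from `D_{L,r√n/(αp)}`", = Lemma 3.4, classical with the `LWE` oracle,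
followed by Lemma 3.14, quantum; the note after Lemma 3.3: correct "with respect to the randomness
(and quantum measurements) used in the algorithm, and not with respect to the input samples", except
on a negligible fraction of input tuples).

Residual A of the census (`Literature.Computability.Cryptography.regev2009_thm_3_1_oneSampleStage`,
the ONE uniform family `Q` running a single stage of this iteration on a single sample, clauses
(CODE), (BOOT₁), (STEP₁), (PASS₁)) mixes the two lemmas in one machine. This file records the two
lemmas SEPARATELY, as named facts in machine form whose conjunction is weaker to supply and whose
split follows the paper:

* `regev2009_lemma_3_2_sampler` (**residual A_boot**) — Lemma 3.2 in machine form, classical: a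
  polynomial-time string function `boot` reading an instance code `⟨I, ρ⟩` and a block of
  `p_c(|⟨I, ρ⟩|)` uniform coins, always writing the framed code of an integer vector of dimension `n`
  (coordinates in the input basis) of code length `≤ L_b(|⟨I, ρ⟩|)` (FORMAT), whose output on uniform coins
  decodes to a lattice vector within statistical distance `ν(n)` of `D_{L(I),ρ}` whenever
  `ρ > 2^{2n} λ_n(L(I))`, eventually in `n`, `ν` negligible (LAW);
* `regev2009_lemma_3_3_stepMachine q α` (**residual A_step**) — Lemma 3.3 in machine form for ONE output
  sample GIVEN the previous samples: under the hypotheses of Theorem 3.1 (the binders of residual A) a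
  poly-time computable rational ratio `θ(n) ≥ α q/√n` and, for every requested code length `L_req`, ONE
  uniform poly-time quantum family `Q` with batch polynomial `p_N ≥ 1`, code polynomial `L ≥ L_req` and a
  negligible `ν₁` satisfying, eventually in `n`, on the stage inputs `⟨⟨x, ⟨1^{k+1}, y⟩⟩, e_j⟩` of
  stages `k + 1 ≥ 1` ONLY: (CODE⁺) the output format, (STEP₁) the one-sample law of Lemma 3.3 with the
  average failure bound, (PASS₁) identity at padding stages — verbatim the clauses of residual A at
  stages `≥ 1`, with the real ratio `θ` of residual A specialised to (the cast of) a rational poly-time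
  one (the machine writes the radii `ρ_k = θ^{3n-k} r` into instance codes).

What is NOT in this file: the dispatcher assembling ONE family from `boot` and `Q` (stage `0`: draw
coins, rescale the radius to `ρ₀ = θ(n)^{3n} r`, run `boot`; stages `≥ 1`: run `Q`) and the proof
`regev2009_lemma_3_2_sampler → regev2009_lemma_3_3_stepMachine q α → regev2009_thm_3_1_oneSampleStage q α`
— that is the theorem `regev2009_thm_3_1_oneSampleStage_of_boot_of_step` of
`RegevReductionOneSampleStage.lean` (coins by `QuantumComplexity.CoinPrefix`, classical pre/post-processing
by `QuantumComplexity.CWrap`, laws by `CoinPrefix.kernel_eq_bind` / `CWrap.map_kernel_eq_of_read`).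
Neither fact restates residual A or a target: A_boot has no quantum machine and no `LWE` oracle (it is
the law of LLL + rounding, `RegevBootstrap.lean`, as a program), A_step says nothing about stage `0`.

## Faithfulness notes

* Lemma 3.2's "`2^{-Ω(n)}`-close" is recorded as "`ν`-close, `ν` negligible" (as everywhere in the
  tree's `DGS` interfaces, §2 p. 11); the coins are an explicit uniform block of polynomial length (the
  continuous Gaussian of the proof is sampled to polynomial precision from them — part of the fact).
* In A_step the `LWE` oracle is a WORST-CASE search-`LWE_{q,Ψ̄_α}` solver with failure `≤ 2^{-cn}`, as in
  residual A (the passage from the average-case solver is the proved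
  `Regev2009.searchLWE_worstCase_of_avgCase`); `Ψ̄_α = discretizedGaussian (q n) (α n)`, `η_ε =
  smoothingParameter`, `D_{L,r} = discreteGaussian L r 0`, radii `Regev2009.levelRadius`, batch codes
  `Regev2009.encBatch`, the ideal batch law `Regev2009.idealBatchZ`, copy inputs
  `⟨stageInput x k y, Regev2009.StageCopies.idxWord (Regev2009.StageCopies.KOf p_N x k y) j⟩` — all as in
  residual A.

## References

* O. Regev, *On lattices, learning with errors, random linear codes, and cryptography*, J. ACM 56 (2009),
  art. 34; author's version arXiv:2401.03703: Theorem 3.1 (proof, p. 15), Lemma 3.2 (p. 15, proof p. 16),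
  Lemma 3.3 (p. 15) with the note following it, Lemmas 3.4, 3.14. [Regev2009] [RegevLWE2009]
* A. K. Lenstra, H. W. Lenstra, L. Lovász, *Factoring polynomials with rational coefficients*, Math. Ann.
  261 (1982) (LLL, used in Lemma 3.2). [LenstraLenstraLovasz1982]
-/

noncomputable section

namespace Literature.Computability.Cryptography

open Filter _root_.Computability Literature.Computability.Complexity Literature.Computability.Cryptography.LWE
  Literature.Algebra.EuclideanLattices Literature.Computability.QuantumComplexity

variable (q : ℕ → ℕ) [∀ n, NeZero (q n)] (α : ℕ → ℝ)

/-- NAMED FACT (residual A_boot) — **Regev 2009, Lemma 3.2 (bootstrapping) in machine form, classical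
with explicit coins**: "There exists an efficient algorithm that, given any `n`-dimensional lattice `L`
and `r > 2^{2n} λ_n(L)`, outputs a sample from a distribution that is within statistical distance
`2^{-Ω(n)}` of `D_{L,r}`" (p. 15; proof p. 16: LLL-reduce, sample a continuous Gaussian, reduce modulo
the basic parallelepiped / round). Machine form: a string function `boot ∈ FP`, a coin polynomial `p_c`,
a code-length polynomial `L_b` and a negligible `ν` such that (FORMAT) on `⟨⟨I, ρ⟩, c⟩` (an instance
code and any coin string) `boot` writes exactly the framed code `⟨vecCode n v, ε⟩` of an integer
coordinate vector `v ∈ ℤⁿ`, `n = dim I` (the format residual A's clause (CODE) asks of every output; the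
`DGS` reader `decodeLatticeVector n` reads `v` off it), with `|vecCode n v| ≤ L_b(|⟨I, ρ⟩|)`, and (LAW)
for all large `n`, for every nonsingular
`I` of dimension `n` and rational `ρ > 2^{2n} λ_n(L(I))`, on `p_c(|⟨I, ρ⟩|)` uniform coins the decoded
output is within statistical distance `ν(n)` of `D_{L(I),ρ}` (in coordinates). No quantum machine, no
oracle. Users take `(hB : regev2009_lemma_3_2_sampler)`. PROVED: `regev2009_lemma_3_2_sampler_holds`
(`RegevReductionLemma32Sampler.lean`: LLL → `n` BLPRS/GPV rejection samplers → Babai round-off, `ν = 241n²/2ⁿ`).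
[cite: Regev2009, Lemma 3.2 (p. 15, proof p. 16); LenstraLenstraLovasz1982] -/
def regev2009_lemma_3_2_sampler : Prop :=
  ∃ (boot : List Bool → List Bool) (pc Lb : Polynomial ℕ) (ν : ℕ → ℝ),
    boot ∈ FP ∧ IsNegligible ν ∧
    (∀ (I : LatticeInstance) (ρ : ℚ) (c : List Bool), ∃ v : Fin I.n → ℤ,
      boot (boolPair (GapSVPInstance.encode (I, ρ)) c) = boolPair (Regev2009.vecCode I.n v) [] ∧
        (Regev2009.vecCode I.n v).length ≤ Lb.eval (GapSVPInstance.encode (I, ρ)).length) ∧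
    ∀ᶠ n : ℕ in atTop, ∀ (I : LatticeInstance) (ρ : ℚ), I.n = n → I.IsNonsingular →
      (2 : ℝ) ^ (2 * I.n) * successiveMinimum I.lattice I.n < ρ →
      ((PMF.uniformOfFintype (QReg (pc.eval (GapSVPInstance.encode (I, ρ)).length))).map
          fun c => decodeLatticeVector I.n (boot (boolPair (GapSVPInstance.encode (I, ρ)) (List.ofFn c)))).tvDist
        ((discreteGaussian I.lattice (ρ : ℝ) 0).map I.intCoords) ≤ ν I.n

/-- NAMED FACT (residual A_step) — **Regev 2009, Lemma 3.3 (the iterative step) in machine form, for ONE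
output sample given the previous samples**: "there exists a constant `c > 0` and an efficient quantum
algorithm that, given any `n`-dimensional lattice `L`, a number `r > √2 p η_ε(L)`, and `n^c` samples
from `D_{L,r}`, produces a sample from `D_{L,r√n/(αp)}`" (p. 15; = Lemma 3.4 + Lemma 3.14; the note
after it: the output distribution is correct with respect to the algorithm's own randomness for all but
a negligible fraction of input tuples). Machine form, under the hypotheses of Theorem 3.1 exactly as in
residual A (`m` polynomially bounded, `(q, α, m)` poly-time computable, `0 < α < 1 < αq/(2√n)`
eventually, a uniform poly-time quantum family `W` solving search-`LWE_{q,Ψ̄_α}` in the worst case with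
failure `≤ 2^{-cn}`, a negligible positive `ε`): there is a poly-time computable RATIONAL ratio
`θ(n) ≥ α q/√n` (`n ≥ 1`) and, for every requested code length `L_req`, ONE uniform poly-time quantum
family `Q` with polynomials `p_N ≥ 1` (batch size), `L ≥ L_req` (code length) and a negligible `ν₁` such
that for all large `n`, for every nonsingular `I` of dimension `n` and rational `r` (`x = ⟨I, r⟩`,
radii `ρ_k = θ(n)^{3n-k} r`), on the copy inputs `⟨⟨x, ⟨1^{k+1}, y⟩⟩, e_j⟩` of stages `k + 1 ≥ 1`:
(CODE⁺) every possible output starts with the framed code of the vector read off it, of length `≤ L(|x|)`;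
(STEP₁) at a stage `k + 1 ≤ 3n` with `ρ_k > √2 q η_ε(L(I))`, on every padded batch code of a batch `b`
with codes `≤ L(|x|)`, every copy `j < p_N(n)` decodes to a vector `F₁(b)`-close to `D_{L(I),ρ_{k+1}}`,
`F₁ ≥ 0`, `E_{b ∼ D_{L(I),ρ_k}^{⊗ p_N(n)}}[min 1 F₁(b)] ≤ ν₁(n)`; (PASS₁) at stages `k + 1 > 3n` copy `j`
writes `b_j` back exactly. (Residual A's clauses at stages `≥ 1`, its real ratio specialised to a rational
poly-time one.) Users take `(hS : regev2009_lemma_3_3_stepMachine q α)`.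
TYPING NOTE (referee finding F-5.1, answered in `RegevReductionStepRatio.lean`): Lemma 3.3 outputs
`D_{L,ρ_k√n/(αq)}` exactly, while (STEP₁) names `D_{L,ρ_{k+1}} = D_{L,ρ_k/θ}` for a RATIONAL `θ ≥ αq/√n`;
this is not a stronger contraction demand, because (STEP₁) is approximate (`F₁`, `ν₁`): with the
poly-time ladder `θ = Regev2009.stepRatio a q ≤ (αq/√n)(1 + 2⁻ⁿ)` the two laws are `n/2ⁿ`-close
(`Regev2009.tvDist_regevStep_levelRadius_le`), and this fact is the proved consequence
`regev2009_lemma_3_3_stepMachine_of_exact` of `regev2009_lemma_3_3_stepExact q α` (same text, exact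
Lemma-3.3 reference law, ladder fixed) — prove THAT one.
[cite: Regev2009, Lemma 3.3 (p. 15) and the note following it, with Lemmas 3.4, 3.14] -/
def regev2009_lemma_3_3_stepMachine : Prop :=
  ∀ (m : ℕ → ℕ) (_ : IsPolyBounded m) (_ : IsPolyTimeParams q α m)
    (_ : ∀ᶠ n : ℕ in atTop, 0 < α n ∧ α n < 1 ∧ 2 * Real.sqrt n < α n * q n)
    (_ : ∃ (W : UniformQCircuitFamily) (c : ℝ), 0 < c ∧
      W.SolvesSearchLWEWorstCase q (fun n => discretizedGaussian (q n) (α n)) m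
        fun n => (2 : ℝ) ^ (-(c * n)))
    (ε : ℕ → ℝ), IsNegligible ε → (∀ n, 0 < ε n) →
    ∃ θ : ℕ → ℚ, PolyTimeComputable unaryEncodeNat encodeRat θ ∧
      (∀ n, 0 < n → α n * q n / Real.sqrt n ≤ θ n) ∧
      ∀ Lreq : Polynomial ℕ, ∃ (Q : UniformQCircuitFamily) (pN L : Polynomial ℕ) (ν₁ : ℕ → ℝ),
        IsNegligible ν₁ ∧ (∀ n, 0 < pN.eval n) ∧ (∀ t, Lreq.eval t ≤ L.eval t) ∧
        ∀ᶠ n : ℕ in atTop, ∀ (I : LatticeInstance) (r : ℚ) (x : List Bool), I.n = n → I.IsNonsingular →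
          x = GapSVPInstance.encode (I, r) →
          (∀ (k : ℕ) (y : List Bool) (j : ℕ) (s : List Bool),
            s ∈ (Q.kernel (boolPair (stageInput x (k + 1) y)
              (Regev2009.StageCopies.idxWord (Regev2009.StageCopies.KOf pN x (k + 1) y) j))).support →
            boolPair (Regev2009.vecCode I.n (decodeLatticeVector I.n s)) [] <+: s ∧
              (Regev2009.vecCode I.n (decodeLatticeVector I.n s)).length ≤ L.eval x.length) ∧
          (∀ k, k < 3 * I.n →
            Real.sqrt 2 * q I.n * smoothingParameter I.lattice (ε I.n) <
                Regev2009.levelRadius (θ I.n) (3 * I.n) r k →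
            ∃ F₁ : (Fin (pN.eval I.n) → Fin I.n → ℤ) → ℝ, (∀ b, 0 ≤ F₁ b) ∧
              (∀ b : Fin (pN.eval I.n) → Fin I.n → ℤ,
                (∀ j, (Regev2009.vecCode I.n (b j)).length ≤ L.eval x.length) →
                ∀ (pad : List Bool) (j : ℕ), j < pN.eval I.n →
                  ((Q.kernel (boolPair (stageInput x (k + 1) (Regev2009.encBatch I.n (pN.eval I.n) b ++ pad))
                      (Regev2009.StageCopies.idxWord (Regev2009.StageCopies.KOf pN x (k + 1)
                        (Regev2009.encBatch I.n (pN.eval I.n) b ++ pad)) j))).map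
                      (decodeLatticeVector I.n)).tvDist
                    ((discreteGaussian I.lattice (Regev2009.levelRadius (θ I.n) (3 * I.n) r (k + 1)) 0).map
                      I.intCoords) ≤ F₁ b) ∧
              ∑' b, (Regev2009.idealBatchZ I (pN.eval I.n) (Regev2009.levelRadius (θ I.n) (3 * I.n) r k) b).toReal *
                  min 1 (F₁ b) ≤ ν₁ I.n) ∧
          (∀ k, 3 * I.n ≤ k → ∀ b : Fin (pN.eval I.n) → Fin I.n → ℤ,
            (∀ j, (Regev2009.vecCode I.n (b j)).length ≤ L.eval x.length) →
            ∀ (pad : List Bool) (j : ℕ) (hj : j < pN.eval I.n),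
              (Q.kernel (boolPair (stageInput x (k + 1) (Regev2009.encBatch I.n (pN.eval I.n) b ++ pad))
                  (Regev2009.StageCopies.idxWord (Regev2009.StageCopies.KOf pN x (k + 1)
                    (Regev2009.encBatch I.n (pN.eval I.n) b ++ pad)) j))).map
                  (decodeLatticeVector I.n) = PMF.pure (b ⟨j, hj⟩))

end Literature.Computability.Cryptography

end
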